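import Summits.CriticalPhenomena.Ising3D.TaylorTableOddHeadDeltaCheck
import Mathlib.Tactic.Linarith
import Mathlib.Tactic.Positivity
import Mathlib.Tactic.Ring
import HarnessLib

/-!
# The TABLE layer of a derivative certificate, XXIX: the MERGED sign test of the odd head layer (zeroth δ-order combined coefficientwise)
(cell `pub-ising3x`, seat boot-1 gen 9; gate (g2) — a cheaper and wider-box final test for the odd FAST head layer; the cell theorem
using it is the next file `TaylorTableOddHeadDeltaMergedCells`)

HONEST FRAMING: lottery ticket; floor = tightest certified 3D Ising CFT bounds; no exact-solution
claim without a proof. Island framing: certified exclusion region at stated derivative order and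
assumptions; not a determination of the 3D Ising critical exponents beyond that.

The odd head value of a cell is `V₄ − V₅ + c₃V₃ + c₀V₀ + c_tV_t` (five family head sums, three interval scalars; file XXVI). On
REAL functionals the two Ψ-conversion pieces `c₀V₀` and `c_tV_t` are each 10⁵–10⁷ times the value and cancel (their full series
are equal by the conversion identity; HOME/pub-ising3x-boot-1/HEAD-DELTA.md §7): the affine test `oddCore` of file XXVI bounds the
five families SEPARATELY over a sub-interval (`mulLo` of each family's range), so it pays for the VARIATION of each huge piece and
needs deep bisection / tiny cells. This file's test **`oddCoreM`** first MERGES the zeroth δ-order of the five families into ONE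
interval polynomial `mergedR0 = T₄⁰ − T₅⁰ + C₃·T₃⁰ + C₀·P₀ + C_t·T_t⁰` (coefficientwise `addI` / `smulI` / `smulIntI`, so the cancellation
happens coefficient by coefficient) and takes ONE `lowB` of it on the sub-interval; the first and second δ-orders stay per family
(`absB` bounds times `W`, `W²`, interval scalars by `MI.absHi`). Soundness **`oddCoreM_sound`** / **`posOnOddM_sound`** has literally
the hypotheses and the conclusion of `oddCore_sound` / `posOnOdd_sound`, so the cell theorem goes through unchanged (next file).
Also: the structural half `oddHeadStructOK` of the final Boolean and **`oddHeadFinalOKΔM`** (= structural ∧ `posOnOddM`).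
No new mathematics (interval arithmetic bookkeeping). [folklore]
-/

namespace Summit.CriticalPhenomena.Ising3D

open Finset Set
open Literature.Analysis.ValidatedNumerics Literature.Analysis.ValidatedNumerics.PolyMP
open Literature.Analysis.ValidatedNumerics.NumericsMP (MI)
open Literature.MathematicalPhysics.QuantumFieldTheory.ConformalBootstrap3D
open Literature.MathematicalPhysics.QuantumFieldTheory.ConformalBootstrap3D.HRTM (pivOK)

/-! ### The merged zeroth-order polynomial and the test -/

/-- The zeroth δ-order of `V₄ − V₅ + c₃V₃ + c₀V₀ + c_tV_t` as ONE interval polynomial in the cell variable. [folklore] -/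
def mergedR0 (S : ℕ) (T3 T4 T5 : ITriple) (P0 : IPoly) (Tt : ITriple) (C3 C0 Ct : MI) : IPoly :=
  addI (addI (addI (addI T4.1 (smulIntI (-1) T5.1)) (smulI S C3 T3.1)) (smulI S C0 P0)) (smulI S Ct Tt.1)

/-- **Merged core test** on `[lo, hi]`: `lowB(mergedR0)` beats the per-family first/second δ-order bounds. [folklore] -/
def oddCoreM (S : ℕ) (T3 T4 T5 : ITriple) (P0 : IPoly) (Tt : ITriple) (Wb Wσ Wt : ℚ) (C3 C0 Ct : MI)
    (lo hi : ℚ) : Bool :=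
  decide (Wσ * ((absB S T4.2.1 lo hi : ℚ) + (absB S T5.2.1 lo hi : ℚ)) +
      Wσ ^ 2 * ((absB S T4.2.2 lo hi : ℚ) + (absB S T5.2.2 lo hi : ℚ)) +
      (MI.absHi C3 : ℚ) / S * (Wb * (absB S T3.2.1 lo hi : ℚ) + Wb ^ 2 * (absB S T3.2.2 lo hi : ℚ)) +
      (MI.absHi Ct : ℚ) / S * (Wt * (absB S Tt.2.1 lo hi : ℚ) + Wt ^ 2 * (absB S Tt.2.2 lo hi : ℚ)) <
    (lowB S (mergedR0 S T3 T4 T5 P0 Tt C3 C0 Ct) lo hi : ℚ))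

/-- Bisection of the merged test to depth `d`. [folklore] -/
def posOnOddM (S : ℕ) (T3 T4 T5 : ITriple) (P0 : IPoly) (Tt : ITriple) (Wb Wσ Wt : ℚ) (C3 C0 Ct : MI) :
    ℕ → ℚ → ℚ → Bool
  | 0, a, b => oddCoreM S T3 T4 T5 P0 Tt Wb Wσ Wt C3 C0 Ct a b
  | d + 1, a, b =>
      oddCoreM S T3 T4 T5 P0 Tt Wb Wσ Wt C3 C0 Ct a b ||
        (posOnOddM S T3 T4 T5 P0 Tt Wb Wσ Wt C3 C0 Ct d a ((a + b) / 2) &&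
          posOnOddM S T3 T4 T5 P0 Tt Wb Wσ Wt C3 C0 Ct d ((a + b) / 2) b)

/-! ### Elementary bounds -/

/-- From `|y|·S ≤ B`: `−B ≤ y·S ≤ B`. [folklore] -/
theorem bounds_of_abs_mul_le {S : ℕ} (hS : 0 < S) {y B : ℝ} (h : |y| * S ≤ B) : -B ≤ y * S ∧ y * S ≤ B := by
  have hSr : (0 : ℝ) < S := by exact_mod_cast hS
  have h' : |y * S| ≤ B := by rwa [abs_mul, abs_of_pos hSr]
  exact abs_le.mp h'

/-- `|δ^k·p(x)|·S ≤ W^k·absB` for `|δ| ≤ W`, `p ∈ P`, `x ∈ [lo, hi]`, as the two one-sided bounds. [folklore] -/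
theorem delta_term_bounds {S : ℕ} (hS : 0 < S) {δ : ℝ} {W : ℚ} (hδ : |δ| ≤ W) {as : List ℝ} {P : IPoly}
    (h : PMem S as P) {lo hi : ℚ} {x : ℝ} (hlo : (lo : ℝ) ≤ x) (hhi : x ≤ hi) (k : ℕ) :
    -((W : ℝ) ^ k * (absB S P lo hi : ℝ)) ≤ δ ^ k * evalR as x * S ∧
      δ ^ k * evalR as x * S ≤ (W : ℝ) ^ k * (absB S P lo hi : ℝ) := by
  have e := abs_le_absB hS h hlo hhi
  have hδk : |δ| ^ k ≤ (W : ℝ) ^ k := pow_le_pow_left₀ (abs_nonneg δ) hδ k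
  have hW0 : (0 : ℝ) ≤ (W : ℝ) ^ k := le_trans (pow_nonneg (abs_nonneg δ) k) hδk
  have hb : |δ ^ k * evalR as x| * S ≤ (W : ℝ) ^ k * absB S P lo hi := by
    rw [abs_mul, abs_pow, mul_assoc]
    exact mul_le_mul hδk e (by positivity) hW0
  exact bounds_of_abs_mul_le hS hb

/-- `|c·δ^k·p(x)|·S ≤ (absHi C / S)·W^k·absB` for `c ∈ C`, `|δ| ≤ W`, `p ∈ P`, `x ∈ [lo, hi]`, two one-sided bounds. [folklore] -/
theorem smul_delta_term_bounds {S : ℕ} (hS : 0 < S) {c : ℝ} {C : MI} (hc : MI.mem S c C) {δ : ℝ} {W : ℚ}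
    (hδ : |δ| ≤ W) {as : List ℝ} {P : IPoly} (h : PMem S as P) {lo hi : ℚ} {x : ℝ} (hlo : (lo : ℝ) ≤ x) (hhi : x ≤ hi)
    (k : ℕ) : -((MI.absHi C : ℝ) / S * ((W : ℝ) ^ k * (absB S P lo hi : ℝ))) ≤ c * (δ ^ k * evalR as x) * S ∧
      c * (δ ^ k * evalR as x) * S ≤ (MI.absHi C : ℝ) / S * ((W : ℝ) ^ k * (absB S P lo hi : ℝ)) := by
  have hSr : (0 : ℝ) < S := by exact_mod_cast hS
  have e := abs_le_absB hS h hlo hhi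
  have hδk : |δ| ^ k ≤ (W : ℝ) ^ k := pow_le_pow_left₀ (abs_nonneg δ) hδ k
  have hW0 : (0 : ℝ) ≤ (W : ℝ) ^ k := le_trans (pow_nonneg (abs_nonneg δ) k) hδk
  have ha := MI.abs_le_absHi hc
  have hc' : |c| ≤ (MI.absHi C : ℝ) / S := by rw [le_div_iff₀ hSr]; exact ha
  have h1 : |δ ^ k * evalR as x| * S ≤ (W : ℝ) ^ k * absB S P lo hi := by
    rw [abs_mul, abs_pow, mul_assoc]
    exact mul_le_mul hδk e (by positivity) hW0
  have hA0 : (0 : ℝ) ≤ (MI.absHi C : ℝ) / S := le_trans (abs_nonneg c) hc'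
  have hb : |c * (δ ^ k * evalR as x)| * S ≤ (MI.absHi C : ℝ) / S * ((W : ℝ) ^ k * absB S P lo hi) := by
    rw [abs_mul, mul_assoc]
    exact mul_le_mul hc' h1 (by positivity) hA0
  exact bounds_of_abs_mul_le hS hb

/-! ### Soundness -/

/-- **Soundness of the merged core test** (same hypotheses and conclusion as `oddCore_sound`). [folklore] -/
theorem oddCoreM_sound {S : ℕ} (hS : 0 < S) {T3 T4 T5 Tt : ITriple} {P0 : IPoly} {Wb Wσ Wt : ℚ} {C3 C0 Ct : MI}
    {lo hi : ℚ} (h : oddCoreM S T3 T4 T5 P0 Tt Wb Wσ Wt C3 C0 Ct lo hi = true)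
    {r3 r4 r5 rt : List ℝ × List ℝ × List ℝ} {r0 : List ℝ} (m3 : PMem3 S r3 T3) (m4 : PMem3 S r4 T4)
    (m5 : PMem3 S r5 T5) (m0 : PMem S r0 P0) (mt : PMem3 S rt Tt) {c3 c0 ct : ℝ} (hc3 : MI.mem S c3 C3)
    (hc0 : MI.mem S c0 C0) (hct : MI.mem S ct Ct) {x : ℝ} (hlo : (lo : ℝ) ≤ x) (hhi : x ≤ hi) {δb δσ δt : ℝ}
    (hδb : |δb| ≤ Wb) (hδσ : |δσ| ≤ Wσ) (hδt : |δt| ≤ Wt) :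
    0 < val3 r4 x δσ - val3 r5 x δσ + c3 * val3 r3 x δb + c0 * evalR r0 x + ct * val3 rt x δt := by
  simp only [oddCoreM, decide_eq_true_eq] at h
  have hSr : (0 : ℝ) < S := by exact_mod_cast hS
  -- the merged zeroth order
  have hm : PMem S (addR (addR (addR (addR r4.1 (smulR (((-1 : ℤ) : ℝ)) r5.1)) (smulR c3 r3.1)) (smulR c0 r0))
      (smulR ct rt.1)) (mergedR0 S T3 T4 T5 P0 Tt C3 C0 Ct) :=
    pmem_addI (pmem_addI (pmem_addI (pmem_addI m4.fst (pmem_smulIntI (-1) m5.fst)) (pmem_smulI hS hc3 m3.fst))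
      (pmem_smulI hS hc0 m0)) (pmem_smulI hS hct mt.fst)
  have e0 := lowB_le hS hm hlo hhi
  simp only [evalR_addR, evalR_smulR, Int.cast_neg, Int.cast_one] at e0
  -- first / second δ-orders, per family
  have b41 := (delta_term_bounds hS hδσ m4.snd hlo hhi 1).1
  have b42 := (delta_term_bounds hS hδσ m4.thd hlo hhi 2).1
  have b51 := (delta_term_bounds hS hδσ m5.snd hlo hhi 1).2
  have b52 := (delta_term_bounds hS hδσ m5.thd hlo hhi 2).2
  have b31 := (smul_delta_term_bounds hS hc3 hδb m3.snd hlo hhi 1).1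
  have b32 := (smul_delta_term_bounds hS hc3 hδb m3.thd hlo hhi 2).1
  have bt1 := (smul_delta_term_bounds hS hct hδt mt.snd hlo hhi 1).1
  have bt2 := (smul_delta_term_bounds hS hct hδt mt.thd hlo hhi 2).1
  have hd : (Wσ : ℝ) * ((absB S T4.2.1 lo hi : ℝ) + (absB S T5.2.1 lo hi : ℝ)) +
      (Wσ : ℝ) ^ 2 * ((absB S T4.2.2 lo hi : ℝ) + (absB S T5.2.2 lo hi : ℝ)) +
      (MI.absHi C3 : ℝ) / S * ((Wb : ℝ) * (absB S T3.2.1 lo hi : ℝ) + (Wb : ℝ) ^ 2 * (absB S T3.2.2 lo hi : ℝ)) +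
      (MI.absHi Ct : ℝ) / S * ((Wt : ℝ) * (absB S Tt.2.1 lo hi : ℝ) + (Wt : ℝ) ^ 2 * (absB S Tt.2.2 lo hi : ℝ)) <
      (lowB S (mergedR0 S T3 T4 T5 P0 Tt C3 C0 Ct) lo hi : ℝ) := by
    exact_mod_cast h
  simp only [pow_one] at b41 b51 b31 bt1 hd
  have key : 0 < (val3 r4 x δσ - val3 r5 x δσ + c3 * val3 r3 x δb + c0 * evalR r0 x + ct * val3 rt x δt) * S := by
    simp only [val3]
    nlinarith [e0, b41, b42, b51, b52, b31, b32, bt1, bt2, hd]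
  exact (mul_pos_iff_of_pos_right hSr).mp key

/-- **Soundness of the bisected merged test** (same shape as `posOnOdd_sound`). [folklore] -/
theorem posOnOddM_sound {S : ℕ} (hS : 0 < S) {T3 T4 T5 Tt : ITriple} {P0 : IPoly} {Wb Wσ Wt : ℚ} {C3 C0 Ct : MI}
    {r3 r4 r5 rt : List ℝ × List ℝ × List ℝ} {r0 : List ℝ} (m3 : PMem3 S r3 T3) (m4 : PMem3 S r4 T4)
    (m5 : PMem3 S r5 T5) (m0 : PMem S r0 P0) (mt : PMem3 S rt Tt) {c3 c0 ct : ℝ} (hc3 : MI.mem S c3 C3)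
    (hc0 : MI.mem S c0 C0) (hct : MI.mem S ct Ct) {δb δσ δt : ℝ}
    (hδb : |δb| ≤ Wb) (hδσ : |δσ| ≤ Wσ) (hδt : |δt| ≤ Wt) :
    ∀ {d : ℕ} {lo hi : ℚ}, posOnOddM S T3 T4 T5 P0 Tt Wb Wσ Wt C3 C0 Ct d lo hi = true →
      ∀ {x : ℝ}, (lo : ℝ) ≤ x → x ≤ hi →
        0 < val3 r4 x δσ - val3 r5 x δσ + c3 * val3 r3 x δb + c0 * evalR r0 x + ct * val3 rt x δt
  | 0, _, _, h, _, hlo, hhi => oddCoreM_sound hS h m3 m4 m5 m0 mt hc3 hc0 hct hlo hhi hδb hδσ hδt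
  | d + 1, a, b, h, x, hlo, hhi => by
      simp only [posOnOddM, Bool.or_eq_true, Bool.and_eq_true] at h
      rcases h with h | ⟨ha, hb⟩
      · exact oddCoreM_sound hS h m3 m4 m5 m0 mt hc3 hc0 hct hlo hhi hδb hδσ hδt
      · have hmR : (((a + b) / 2 : ℚ) : ℝ) = ((a : ℝ) + b) / 2 := by push_cast; ring
        rcases le_or_gt x (((a : ℝ) + b) / 2) with hx | hx
        · exact posOnOddM_sound hS m3 m4 m5 m0 mt hc3 hc0 hct hδb hδσ hδt ha hlo (by rw [hmR]; exact hx)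
        · exact posOnOddM_sound hS m3 m4 m5 m0 mt hc3 hc0 hct hδb hδσ hδt hb (by rw [hmR]; exact hx.le) hhi

/-! ### The final Boolean of a cell, merged form -/

/-- Structural half of the final check (scale/degree/pivots/`t`-range/`κ₀`/head indices/tiling) — identical to the first six
conjuncts of `oddHeadFinalOKΔ`. [folklore] -/
def oddHeadStructOK (R : OddHeadRowsΔ) (C : EvenCellTM) (t₁ t₂ : ℚ) (κ₀ : ℚ) (ps : List HeadPartOdd) : Bool :=
  decide (2 ≤ C.D) && pivOK C.ctr C.ℓ C.e C.nF && decide (t₁ ≤ t₂) && decide (0 < κ₀) &&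
    (C.F.all fun q => decide (q.2 < R.J)) && tilesOK 0 (ps.map HeadPartOdd.v3) C.F.length

/-- **Final check, odd head, MERGED form** (one declaration per cell). [folklore] -/
def oddHeadFinalOKΔM (R : OddHeadRowsΔ) (dP : ℕ) (C : EvenCellTM) (t₁ t₂ : ℚ) (K Mσ Mε : MI) (κ₀ : ℚ)
    (ps : List HeadPartOdd) : Bool :=
  oddHeadStructOK R C t₁ t₂ κ₀ ps &&
    posOnOddM R.S (sumV HeadPartOdd.v3 ps) (sumV HeadPartOdd.v4 ps) (sumV HeadPartOdd.v5 ps)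
      (sumPX (ps.map HeadPartOdd.v0)) (sumV HeadPartOdd.vt ps) R.Wb R.Wσ R.Wt
      (smulRatMI K ((-1) ^ C.ℓ)) (smulRatMI Mσ (κ₀⁻¹ / 2)) (smulRatMI Mε (-(κ₀⁻¹ / 2))) dP (-C.hw) C.hw

end Summit.CriticalPhenomena.Ising3D
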